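import Mathlib.NumberTheory.NumberField.Discriminant.Basic
import Mathlib.NumberTheory.NumberField.InfinitePlace.Embeddings
import Mathlib.LinearAlgebra.Matrix.NonsingularInverse
import HarnessLib

/-!
# Stub plan `CycleAPIAt3`, P3′ lemmas (I): conjugate vectors of independent algebraic numbers (towards `stub_satelliteHeight`)

Crux `stmt-Schanuel-6117` (`Summit.Schanuel.Schanuel.Theses.DiophantineDichotomy.ApproximationProperty`),
route `DiophantineDichotomy`, line `orbit-interpolation-determinant`, registered stub
`stub_satelliteHeight : SatelliteHeight` (vocabulary `…CycleAPIAt3Defs.lean`: the height of a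
`ℚ`-curve of degree `δ` carrying a Galois orbit of `D > 2δ²` points is `≤ C(δ)(h(𝔭)/D + 1)`).
The proof of that stub interpolates the degree-`ν` part `𝔭_ν` of the ideal of the orbit by SMALL
rational forms: the `ℚ`-subspace `𝔭_ν = {G : G(b̄) = 0}` (one `K`-linear condition, `K = ℚ(b̄)`,
`[K:ℚ] = D`) is cut out over the compositum `L` of the conjugate fields by the `D` conjugate
conditions `G(σ b̄) = 0`, whose coefficient rows have absolute height `ν h(b̄)/D` — provided the
rational structure of `𝔭_ν` survives the passage to `L`. This file supplies the two pieces of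
linear algebra which guarantee that (no definitions, nothing about polynomials):

* `conj_linearIndependent` (registered sub-goal): **if `y₁, …, y_t ∈ K` are `ℚ`-linearly
  independent, the conjugate vectors `(σ(y_a))_{σ : K → ℂ}` are `ℂ`-linearly independent** — the
  non-vanishing of the discriminant `det(σ_i(e_k))² ≠ 0` of a `ℚ`-basis of `K` (Mathlib's
  `Algebra.discr_not_zero_of_basis`, `Algebra.discr_eq_det_embeddingsMatrixReindex_pow_two`);
  `SatelliteHeightConjugates.linearIndependent_of_lift` transports it to vectors with values in a
  subfield `L ⊂ ℂ` containing the conjugates;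
* `SatelliteHeightConjugates.exists_echelon`: every subspace `V ⊆ F^ι` has a set of PIVOT
  coordinates `I₀` — no non-zero vector of `V` is supported in `I₀`, and for each free coordinate
  `i ∉ I₀` there is `e_i ∈ V` with `e_i(i) = 1` vanishing at the other free coordinates; these
  `e_i` span `V` (reduced echelon form, by maximality of `I₀`).

Sources: BombieriGubler2006 §1.5 (heights under field extension) for the role of the lemma;
the algebra is folklore (Dedekind's independence of characters / non-degeneracy of the trace form,
as in Mathlib `Mathlib.RingTheory.Discriminant`).
-/

noncomputable section

-- `Summit.Schanuel.Schanuel.…` is the mandated summit/sub-problem namespace (single-conjunct summit), hence: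
set_option linter.dupNamespace false

namespace Summit.Schanuel.Schanuel.Cruxes.ApproximationProperty.OrbitInterpolationDeterminant

open scoped BigOperators

/-- **Registered sub-goal `conj_linearIndependent`** (aux for `stub_satelliteHeight`): for a number
field `K` and `ℚ`-linearly independent `y : α → K`, the conjugate vectors
`a ↦ (σ(y a))_{σ : K →+* ℂ}` are `ℂ`-linearly independent. (Extend `y` to a `ℚ`-basis `e` of `K`;
the square matrix `(σ(e_k))_{σ,k}` has `det² = disc(e) ≠ 0`, so its rows `k ↦ (σ(e_k))_σ` are
independent, and the `y a` are among the `e_k`.) [folklore] -/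
theorem conj_linearIndependent : ∀ (K : Type) [Field K] [NumberField K] (α : Type) (y : α → K), LinearIndependent ℚ y → LinearIndependent ℂ (fun (a : α) (σ : K →+* ℂ) => σ (y a)) := by
  intro K _ _ α y hy
  classical
  -- extend `range y` to a `ℚ`-basis `B` of `K`, indexed by a set `T ⊇ range y`
  have hs : LinearIndepOn ℚ id (Set.range y) := hy.linearIndepOn_id
  set B := Module.Basis.extend hs with hB_def
  haveI : Fintype ↥(hs.extend (Set.subset_univ _)) := FiniteDimensional.fintypeBasisIndex B
  have hcard : Fintype.card ↥(hs.extend (Set.subset_univ _)) = Fintype.card (K →ₐ[ℚ] ℂ) := by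
    rw [AlgHom.card, Module.finrank_eq_card_basis B]
  set e : ↥(hs.extend (Set.subset_univ _)) ≃ (K →ₐ[ℚ] ℂ) := Fintype.equivOfCardEq hcard with he_def
  -- the matrix `(φ(B t))` is invertible: `det² = discr ≠ 0`
  have hdet : (Algebra.embeddingsMatrixReindex ℚ ℂ B e).det ≠ 0 := by
    intro h
    have h2 := Algebra.discr_eq_det_embeddingsMatrixReindex_pow_two ℚ ℂ B e
    rw [h, zero_pow two_ne_zero, map_eq_zero] at h2
    exact Algebra.discr_not_zero_of_basis ℚ B h2
  have hrows : LinearIndependent ℂ (Algebra.embeddingsMatrixReindex ℚ ℂ B e).row :=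
    Matrix.linearIndependent_rows_iff_isUnit.mpr
      ((Matrix.isUnit_iff_isUnit_det _).mpr (Ne.isUnit hdet))
  -- its rows are the conjugate vectors of the `B t`, read through `e`
  have hrow_eq : (Algebra.embeddingsMatrixReindex ℚ ℂ B e).row =
      (LinearEquiv.funCongrLeft ℂ ℂ e) ∘ (fun t => fun φ : K →ₐ[ℚ] ℂ => φ (B t)) := by
    funext t j
    simp [Matrix.row, Algebra.embeddingsMatrixReindex, Algebra.embeddingsMatrix_apply,
      LinearEquiv.funCongrLeft_apply]
  rw [hrow_eq] at hrows
  have hfam : LinearIndependent ℂ (fun t : ↥(hs.extend (Set.subset_univ _)) =>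
      fun φ : K →ₐ[ℚ] ℂ => φ (B t)) := LinearIndependent.of_comp _ hrows
  -- restrict to the sub-family indexed by `α`
  set ι' : α → ↥(hs.extend (Set.subset_univ _)) :=
    fun a => ⟨y a, Module.Basis.subset_extend hs (Set.mem_range_self a)⟩ with hι'_def
  have hι'inj : Function.Injective ι' := fun a a' h => by
    have h' : y a = y a' := congrArg Subtype.val h
    exact hy.injective h'
  have hsub := hfam.comp ι' hι'inj
  have hsub_eq : (fun t : ↥(hs.extend (Set.subset_univ _)) => fun φ : K →ₐ[ℚ] ℂ => φ (B t)) ∘ ι' =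
      fun a => fun φ : K →ₐ[ℚ] ℂ => φ (y a) := by
    funext a φ
    simp only [Function.comp_apply, ι', hB_def, Module.Basis.extend_apply_self]
  rw [hsub_eq] at hsub
  -- reindex `K →ₐ[ℚ] ℂ` by `K →+* ℂ`
  have hfin : (fun (a : α) (σ : K →+* ℂ) => σ (y a)) =
      (LinearEquiv.funCongrLeft ℂ ℂ (RingHom.equivRatAlgHom : (K →+* ℂ) ≃ (K →ₐ[ℚ] ℂ))) ∘
        (fun a => fun φ : K →ₐ[ℚ] ℂ => φ (y a)) := by
    funext a σ
    simp [LinearEquiv.funCongrLeft_apply, RingHom.equivRatAlgHom]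
  rw [hfin]
  exact hsub.map' _ (LinearEquiv.ker _)

namespace SatelliteHeightConjugates

/-- The same independence for conjugate vectors with values in a field `L` mapping to `ℂ`
(e.g. a subfield of `ℂ` containing all the conjugates): if `j (Y a σ) = σ (y a)` then the
`Y a : (K →+* ℂ) → L` are `L`-linearly independent. [folklore] -/
theorem linearIndependent_of_lift {K L : Type} [Field K] [NumberField K] [Field L] (j : L →+* ℂ)
    {α : Type} [Fintype α] (y : α → K) (hy : LinearIndependent ℚ y) (Y : α → (K →+* ℂ) → L)
    (hY : ∀ a σ, j (Y a σ) = σ (y a)) : LinearIndependent L Y := by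
  classical
  have key := conj_linearIndependent K α y hy
  rw [Fintype.linearIndependent_iff] at key ⊢
  intro g hg a
  have hsum : ∑ a, (j (g a)) • (fun σ : K →+* ℂ => σ (y a)) = 0 := by
    funext σ
    have h := congrFun hg σ
    simp only [Finset.sum_apply, Pi.smul_apply, smul_eq_mul, Pi.zero_apply] at h ⊢
    calc ∑ a, j (g a) * σ (y a) = j (∑ a, g a * Y a σ) := by simp [map_sum, map_mul, hY]
      _ = 0 := by rw [h, map_zero]
  exact (map_eq_zero j).mp (key (fun a => j (g a)) hsum a)

/-- **Pivot coordinates / reduced echelon form of a subspace of `F^ι`.** For every subspace `V`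
there are a finite set `I₀` of pivot coordinates and vectors `e i` such that: no non-zero vector
of `V` vanishes at all free coordinates `i ∉ I₀`; for `i ∉ I₀`, `e i ∈ V`, `e i i = 1` and
`e i i' = 0` for the other free `i'`; and every `v ∈ V` is `∑_{i ∉ I₀} v i • e i`. [folklore] -/
theorem exists_echelon {F : Type*} [Field F] {ι : Type*} [Fintype ι] [DecidableEq ι]
    (V : Submodule F (ι → F)) :
    ∃ (I₀ : Finset ι) (e : ι → ι → F),
      (∀ v ∈ V, (∀ i, i ∉ I₀ → v i = 0) → v = 0) ∧
      (∀ i, i ∉ I₀ → e i ∈ V ∧ e i i = 1 ∧ ∀ i', i' ∉ I₀ → i' ≠ i → e i i' = 0) ∧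
      ∀ v ∈ V, v = ∑ i ∈ I₀ᶜ, v i • e i := by
  classical
  -- `P I`: no non-zero vector of `V` is supported inside `I`
  set P : Finset ι → Prop := fun I => ∀ v ∈ V, (∀ i, i ∉ I → v i = 0) → v = 0 with hP_def
  have hP0 : P ∅ := fun v _ hv => funext fun i => hv i (Finset.notMem_empty i)
  obtain ⟨I₀, hI₀, hmax⟩ := Finset.exists_max_image (Finset.univ.filter P) Finset.card
    ⟨∅, by simp [hP0]⟩
  have hPI₀ : P I₀ := (Finset.mem_filter.mp hI₀).2
  -- maximality: for a free `i`, some `v ∈ V` supported in `insert i I₀` is non-zero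
  have hfree : ∀ i, i ∉ I₀ → ∃ v ∈ V, v i ≠ 0 ∧ ∀ i', i' ∉ I₀ → i' ≠ i → v i' = 0 := by
    intro i hi
    have hnot : ¬ P (insert i I₀) := fun h => by
      have h1 := hmax (insert i I₀) (by simp [h])
      rw [Finset.card_insert_of_notMem hi] at h1
      omega
    simp only [hP_def, not_forall, exists_prop] at hnot
    obtain ⟨v, hvV, hvsupp, hv0⟩ := hnot
    refine ⟨v, hvV, fun hvi => hv0 (hPI₀ v hvV fun i' hi' => ?_), fun i' hi' hne => ?_⟩
    · by_cases h : i' = i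
      · rw [h]; exact hvi
      · exact hvsupp i' (by simp [h, hi'])
    · exact hvsupp i' (by simp [hne, hi'])
  choose! v hvV hvi hvsupp using hfree
  set e : ι → ι → F := fun i => (v i i)⁻¹ • v i with he_def
  have he : ∀ i, i ∉ I₀ → e i ∈ V ∧ e i i = 1 ∧ ∀ i', i' ∉ I₀ → i' ≠ i → e i i' = 0 := by
    intro i hi
    refine ⟨V.smul_mem _ (hvV i hi), ?_, fun i' hi' hne => ?_⟩
    · simp only [e, Pi.smul_apply, smul_eq_mul]
      exact inv_mul_cancel₀ (hvi i hi)
    · simp only [e, Pi.smul_apply, smul_eq_mul, hvsupp i hi i' hi' hne, mul_zero]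
  refine ⟨I₀, e, hPI₀, he, fun w hw => ?_⟩
  -- spanning: `w - ∑ w i • e i` lies in `V` and vanishes at the free coordinates
  have hmem : w - ∑ i ∈ I₀ᶜ, w i • e i ∈ V :=
    V.sub_mem hw (V.sum_mem fun i hi => V.smul_mem _ (he i (Finset.mem_compl.mp hi)).1)
  have hzero := hPI₀ _ hmem fun i' hi' => by
    simp only [Pi.sub_apply, Finset.sum_apply, Pi.smul_apply, smul_eq_mul]
    rw [Finset.sum_eq_single i' (fun i hi hne => by
        rw [(he i (Finset.mem_compl.mp hi)).2.2 i' hi' (Ne.symm hne), mul_zero])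
      (fun h => absurd (Finset.mem_compl.mpr hi') h)]
    rw [(he i' hi').2.1, mul_one, sub_self]
  exact (sub_eq_zero.mp hzero)

end SatelliteHeightConjugates

end Summit.Schanuel.Schanuel.Cruxes.ApproximationProperty.OrbitInterpolationDeterminant

end
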